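import Summits.AtomisticToContinuum.Crystallization.Theorems.FrustratedLawDichotomyAveragingRuleTightFree
import Summits.AtomisticToContinuum.Crystallization.Theorems.FrustratedLawDichotomyOptimalityCut
import Summits.AtomisticToContinuum.Crystallization.Theorems.FrustratedLawDichotomyPairPotentialDoorXMoves
import Summits.AtomisticToContinuum.Crystallization.Theorems.FrustratedLawDichotomyExemptChain

/-!
# FrustratedLawDichotomy · crux `AperiodicFrustratedLawGap` (stmt-AtomisticToContinuum-27623) — «ExemptAbsorption» I: the exemption column INSIDE the
# averaged site feature; the X ball books; the bridge to `SchurTopologicalPricingX`; exempt and tight absorption (decomp-a2c lens-5, g39/g40; critic rows 552, 562)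

The record node `AperiodicFrustratedLawGap ⟸ MuEquilibriumDoor ∧ UP(−0.7175) ∧ Topt♭₄₅(ε, ϱ, K; C_T, D_T) ∧ Eopt♭₄₅(…)` (`…OptimalityCut`) quantifies
`Topt♭₄₅` over ALL finite clusters and refunds `D_T` per NON-`(ε, ϱ, K)`-optimal site.  The ball book of `…AveragingRuleCap/TightFree`
(`T′♭ ⟸ TightFreeMotifPricingCap`, `C_T` eliminated by TIGHT ABSORPTION) has no exemption column.  This file puts the exemption column INTO THE
AVERAGED SITE FEATURE so that `D_T` is eliminated exactly as `C_T` was: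

* §1 `flag P` (indicator feature of a site predicate), `surplusCapX … C_T D_T ExM := surplusCap … C_T + D_T·𝟙[ExM]` — a LOCAL feature whenever the
  predicate `ExM` is MOTIF-DECIDED (`IsLocalFeature ρ₁ (flag ExM)`); the X ball books `BallAveragedPricingCapX` (clusters) / `BallAveragedMotifPricingCapX`
  (radius-`ϱ` motifs, centre only) and ★ `ballAveragedPricingCapX_iff_motif` (motif locality, `ϱ ≥ ρ + ρ₁`; generic `motif_ballAvg_of_local`);
* §2 ★ THE BRIDGE `schurTopologicalPricingX_of_ballAveragedCapX` : X ball book `⟹ SchurTopologicalPricingX … C_T D_T Ex` for ANY cluster-level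
  exemption `Ex` implied by `ExM` on injective `7/10`-separated clusters (exact double count `Σ_i S_i = Σ_j x_j`, `Σ_j 𝟙[ExM] ≤ #Ex`) — PROVED;
* §3 ★ EXEMPT ABSORPTION `exemptAbsorptionCapX` ((n1) «OneBondExemptTransfer» in the strong form «within the book radius»): every ball `B(i, ρ)` holding an
  `ExM` site has `S^X_i ≥ 0` once `D_T ≥ C_T⁰(R, B, e, ρ)`; TIGHT ABSORPTION carries over (`tightAbsorptionCapX`) — PROVED (packing + crude floors,
  verbatim the algebra of `…TightFree.tightAbsorptionCap`).

The census object `EquilibriumMotifPricingCap`, its three-piece case split, the motif-decided exemption of record `NonEquilibriumCore` and the record node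
BY NAME are in `…FrustratedLawDichotomyExemptAbsorptionRecord`.  Why novel (relative to the tree): the X-machinery of the tree prices exemptions through an
abstract rule column (`PairRuleCertificateX`, `MotifTransfer`: the CENTRE of a motif is exempt or not); here the exemption is a summand of the AVERAGED
feature, so ONE exempt site absorbs EVERY ball containing it, and the census object downstream becomes `C_T`- AND `D_T`-free.  All `[folklore]` bookkeeping; 0 sorry.
-/

noncomputable section

namespace Summit.AtomisticToContinuum.Crystallization.Theorems.FrustratedLawDichotomyExemptAbsorption

open scoped BigOperators Classical
open Literature.MathematicalPhysics.StatisticalMechanics (interactionEnergy siteEnergy lennardJones)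
open Summit.AtomisticToContinuum.Crystallization.Theorems.ChargedEnergyGapNegative (E3 eStar)
open Summit.AtomisticToContinuum.Crystallization.Theorems.FrustratedLawDichotomyRangeCut
open Summit.AtomisticToContinuum.Crystallization.Theorems.FrustratedLawDichotomySchurCut
open Summit.AtomisticToContinuum.Crystallization.Theorems.FrustratedLawDichotomyLocalDischargingRule
open Summit.AtomisticToContinuum.Crystallization.Theorems.FrustratedLawDichotomyMotifLemmas
open Summit.AtomisticToContinuum.Crystallization.Theorems.FrustratedLawDichotomyMotifCount (motif_card_le)
open Summit.AtomisticToContinuum.Crystallization.Theorems.FrustratedLawDichotomyRuleToolkit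
open Summit.AtomisticToContinuum.Crystallization.Theorems.FrustratedLawDichotomyRuleToolkitGood
open Summit.AtomisticToContinuum.Crystallization.Theorems.FrustratedLawDichotomyAveragingCut
  (surplus ball ballAvg mem_ball card_ball_pos one_le_card_ball card_ball_le sum_ballAvg sum_surplus goodCount_eq_sum' BallAveragedPricing
   CutBounds Mball one_le_Mball Dfl Dfl_pos CT₀ Dfl_le_CT₀ siteEnergy_ge sum_div_ge_of_one_large W₄₅ e₄₅ CT₄₅ W₄₅_cutBounds)
open Summit.AtomisticToContinuum.Crystallization.Theorems.FrustratedLawDichotomyAveragingRule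
open Summit.AtomisticToContinuum.Crystallization.Theorems.FrustratedLawDichotomyAveragingRuleCap
open Summit.AtomisticToContinuum.Crystallization.Theorems.FrustratedLawDichotomyAveragingRuleTightFree
open Summit.AtomisticToContinuum.Crystallization.Theorems.FrustratedLawDichotomyExemptDoor (SitePred DeepAbsent)
open Summit.AtomisticToContinuum.Crystallization.Theorems.FrustratedLawDichotomyExemptLocOpt
  (LocOpt LocOptFails ExchangeUnstable locOptFails_of_exchangeUnstable)
open Summit.AtomisticToContinuum.Crystallization.Theorems.FrustratedLawDichotomyExemptSplit (SchurTopologicalPricingX SchurElasticPricingX)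
open Summit.AtomisticToContinuum.Crystallization.Theorems.FrustratedLawDichotomyOptimalityCut
  (ToptFourHalf EoptFourHalf aperiodicFrustratedLawGap_of_optimalityCut_fourHalf periodicFrustratedLawGap_of_optimalityCut_fourHalf)
open Summit.AtomisticToContinuum.Crystallization.Theorems.FrustratedLawDichotomyPairPotentialDoorXMoves
  (MoveUnstableLoc exchangeUnstable_of_moveUnstableLoc sum_local_motif injective_of_sep)
open Summit.AtomisticToContinuum.Crystallization.Theorems.FrustratedLawDichotomyExemptRemoval (RemovalUnstable removalUnstable_iff sum_eq_siteEnergy)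
open Summit.AtomisticToContinuum.Crystallization.Theorems.FrustratedLawDichotomyExemptLocalSharp (tailConstSharp tailConstSharp_nonneg abs_tsum_field_le_sharp)
open Summit.AtomisticToContinuum.Crystallization.Theorems.FrustratedLawDichotomyExemptMove (tsum_range_inter_eq_sum_filter)
open Summit.AtomisticToContinuum.Crystallization.Theorems.FrustratedLawDichotomyExemptLocal (sep_range)
open Summit.AtomisticToContinuum.Crystallization.Theorems.FrustratedLawDichotomyExemptChain (locOptFails_of_removalUnstable)

/-! ## §1. Exemption flags as site features; the X-surplus; the X ball books; motif locality -/

/-- **Indicator feature** `𝟙[P]` of a site predicate. -/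
def flag (P : SitePred) : SiteFeature := fun N y j => if P N y j then (1 : ℝ) else 0

/-- `0 ≤ 𝟙[P] ≤ 1`. [folklore] -/
theorem flag_mem (P : SitePred) {N : ℕ} (y : Fin N → E3) (j : Fin N) : 0 ≤ flag P N y j ∧ flag P N y j ≤ 1 := by
  unfold flag; split_ifs <;> norm_num

/-- `𝟙[P] = 1` where `P` holds. [folklore] -/
theorem flag_eq_one {P : SitePred} {N : ℕ} {y : Fin N → E3} {j : Fin N} (h : P N y j) : flag P N y j = 1 := by
  unfold flag; rw [if_pos h]

/-- `𝟙[P] = 0` where `P` fails. [folklore] -/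
theorem flag_eq_zero {P : SitePred} {N : ℕ} {y : Fin N → E3} {j : Fin N} (h : ¬P N y j) : flag P N y j = 0 := by
  unfold flag; rw [if_neg h]

/-- **A MOTIF-DECIDED predicate has a local flag**: if the truth value of `P` at a site is unchanged under passing to any sub-cluster containing the
`ρ₁`-ball of the site, then `𝟙[P]` is a `ρ₁`-local feature. [folklore] -/
theorem isLocalFeature_flag_of_iff {ρ₁ : ℝ} {P : SitePred}
    (h : ∀ (N M : ℕ) (y : Fin N → E3) (φ : Fin M → Fin N), Function.Injective φ → ∀ a : Fin M,
      (∀ k : Fin N, dist (y k) (y (φ a)) ≤ ρ₁ → k ∈ Set.range φ) → (P M (y ∘ φ) a ↔ P N y (φ a))) :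
    IsLocalFeature ρ₁ (flag P) := by
  intro N M y φ hφ a hsub
  unfold flag
  rw [propext (h N M y φ hφ a hsub)]

/-- `Σ_j 𝟙[P](j) = #{j : P j}` (as reals). [folklore] -/
theorem sum_flag_eq_card (P : SitePred) {N : ℕ} (y : Fin N → E3) : ∑ j, flag P N y j = (Nat.card {j : Fin N // P N y j} : ℝ) := by
  unfold flag
  rw [Finset.sum_boole, Nat.card_eq_fintype_card, Fintype.card_subtype]

/-- **`surplusCapX η₀ η₁ D W e κ_T C_T D_T ExM`** — the capped surplus WITH THE EXEMPTION COLUMN: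
`x^X_j = x^D_j(C_T) + D_T·𝟙[ExM j]` (an exempt site is credited `D_T`, exactly as a capped-tightly-good site is credited `C_T`). -/
def surplusCapX (η₀ η₁ D : ℝ) (W : ℝ → ℝ) (e κT CT DT : ℝ) (ExM : SitePred) : SiteFeature := fun N y j =>
  surplusCap η₀ η₁ D W e κT CT N y j + DT * flag ExM N y j

/-- ★ `surplusCapX` is `ρ₁`-LOCAL for `ρ₁ ≥ max (R, 13/10·D + 1)` and a motif-decided `ExM` (`IsLocalFeature ρ₁ (flag ExM)`). [folklore] -/
theorem surplusCapX_isLocal {η₀ η₁ D : ℝ} {W : ℝ → ℝ} {e κT CT DT R ρ₁ : ℝ} {ExM : SitePred} (hW : ∀ r, R ≤ r → W r = 0) (hR : R ≤ ρ₁)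
    (hη₀ : η₀ ≤ 3 / 10) (hη₁ : η₁ ≤ 3 / 10) (hD : 13 / 10 * D + 1 ≤ ρ₁) (hEx : IsLocalFeature ρ₁ (flag ExM)) :
    IsLocalFeature ρ₁ (surplusCapX η₀ η₁ D W e κT CT DT ExM) := by
  intro N M y φ hφ a hsub
  unfold surplusCapX
  rw [surplusCap_isLocal hW hR hη₀ hη₁ hD N M y φ hφ a hsub, hEx N M y φ hφ a hsub]

/-- `x^D_j(C_T) ≤ x^X_j` pointwise (`D_T ≥ 0`). [folklore] -/
theorem surplusCap_le_surplusCapX {η₀ η₁ D : ℝ} {W : ℝ → ℝ} {e κT CT DT : ℝ} {ExM : SitePred} (hDT : 0 ≤ DT) {N : ℕ} (y : Fin N → E3)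
    (j : Fin N) : surplusCap η₀ η₁ D W e κT CT N y j ≤ surplusCapX η₀ η₁ D W e κT CT DT ExM N y j := by
  unfold surplusCapX
  nlinarith [(flag_mem ExM y j).1]

/-- **`BallAveragedPricingCapX ρ η₀ η₁ D W e κ_T C_T D_T ExM`** — the X BALL BOOK on clusters: at every site of every injective `7/10`-separated cluster
the ball average of `x^X` is `≥ 0`. -/
def BallAveragedPricingCapX (ρ η₀ η₁ D : ℝ) (W : ℝ → ℝ) (e κT CT DT : ℝ) (ExM : SitePred) : Prop :=
  ∀ (N : ℕ) (y : Fin N → E3), Function.Injective y → Sep y → ∀ i : Fin N, 0 ≤ ballAvg ρ y (surplusCapX η₀ η₁ D W e κT CT DT ExM N y) i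

/-- **`BallAveragedMotifPricingCapX ρ ϱ …`** — the X ball book checked ONLY at the centre of injective `7/10`-separated radius-`ϱ` motifs. -/
def BallAveragedMotifPricingCapX (ρ ϱ η₀ η₁ D : ℝ) (W : ℝ → ℝ) (e κT CT DT : ℝ) (ExM : SitePred) : Prop :=
  ∀ (M : ℕ) (z : Fin M → E3), Function.Injective z → Sep z → ∀ c : Fin M, (∀ a : Fin M, dist (z a) (z c) ≤ ϱ) →
    0 ≤ ballAvg ρ z (surplusCapX η₀ η₁ D W e κT CT DT ExM M z) c

/-- ★ **THE MOTIF OF A SITE reproduces the ball average of ANY local feature**: `x` `ρ₁`-local, `0 ≤ ρ ≤ ρ₁`, `ϱ ≥ ρ + ρ₁` ⟹ the motif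
`{j : dist (y j) (y i) ≤ ϱ}` has at its centre the ball average the cluster has at `i` (generic form of `…AveragingRuleCap.motif_ballAvgCap`). [folklore] -/
theorem motif_ballAvg_of_local {x : SiteFeature} {ρ ρ₁ ϱ : ℝ} (hx : IsLocalFeature ρ₁ x) (h0 : 0 ≤ ρ) (hρ : ρ ≤ ρ₁) (hϱ : ρ + ρ₁ ≤ ϱ)
    {N : ℕ} {y : Fin N → E3} (hy : Function.Injective y) (hsep : Sep y) (i : Fin N) :
    ∃ (M : ℕ) (z : Fin M → E3) (c : Fin M), Function.Injective z ∧ Sep z ∧ (∀ a : Fin M, dist (z a) (z c) ≤ ϱ) ∧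
      ballAvg ρ z (x M z) c = ballAvg ρ y (x N y) i := by
  set S : Finset (Fin N) := Finset.univ.filter (fun j => dist (y j) (y i) ≤ ϱ) with hS
  have hSdef0 : ∀ j, j ∈ S ↔ dist (y j) (y i) ≤ ϱ := fun j => by simp [hS]
  have hϱ0 : 0 ≤ ϱ := by linarith
  have hiS : i ∈ S := (hSdef0 i).2 (by rw [dist_self]; exact hϱ0)
  let φ : Fin S.card ↪o Fin N := S.orderEmbOfFin rfl
  have hφ : Set.range φ = ↑S := Finset.range_orderEmbOfFin S rfl
  have hiφ : i ∈ Set.range φ := by rw [hφ]; exact hiS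
  obtain ⟨c, hc⟩ := hiφ
  have hSdef : ∀ j, j ∈ S ↔ dist (y j) (y (φ c)) ≤ ϱ := by rw [hc]; exact hSdef0
  have hSr : ∀ k : Fin N, dist (y k) (y (φ c)) ≤ ϱ → k ∈ Set.range φ := fun k hk => by
    rw [hφ]; exact (hSdef k).2 hk
  have hφinj : Function.Injective φ := φ.injective
  set F : TransferRule := avgRule ρ x with hF
  have hF₁ : HasRange ρ F := avgRule_hasRange _ _
  have hF₂ : IsLocal ρ₁ F := avgRule_isLocal hx hρ
  refine ⟨S.card, y ∘ φ, c, hy.comp hφinj, fun a b hab => hsep (φ a) (φ b) (hφinj.ne hab), fun a => ?_, ?_⟩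
  · have ha : φ a ∈ S := by
      have h : φ a ∈ Set.range φ := ⟨a, rfl⟩
      rw [hφ] at h
      exact h
    exact (hSdef (φ a)).1 ha
  · have e1 : x S.card (y ∘ φ) c = x N y (φ c) := hx N S.card y φ hφinj c fun k hk => hSr k (hk.trans (by linarith))
    have e2 : netInflow F S.card (y ∘ φ) c = netInflow F N y (φ c) :=
      netInflow_motif hF₁ hF₂ hϱ (by linarith) (by linarith) φ hφ hSdef
    have h1 := netInflow_avgRule h0 x S.card (y ∘ φ) c
    have h2 := netInflow_avgRule h0 x N y (φ c)
    rw [← hc]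
    rw [← hF] at h1 h2
    linarith

/-- ★★ **THE X BALL BOOK IS MOTIF-LOCAL**: `ϱ ≥ ρ + ρ₁` (`0 ≤ ρ ≤ ρ₁`, `R ≤ ρ₁`, `13/10·D + 1 ≤ ρ₁`, `η₀, η₁ ≤ 3/10`, `W` vanishing from `R` on, `ExM`
motif-decided at radius `ρ₁`) ⟹ `BallAveragedPricingCapX ρ … ⟺ BallAveragedMotifPricingCapX ρ ϱ …`. [folklore] -/
theorem ballAveragedPricingCapX_iff_motif {η₀ η₁ D : ℝ} {W : ℝ → ℝ} {e κT CT DT R ρ ρ₁ ϱ : ℝ} {ExM : SitePred} (hW : ∀ r, R ≤ r → W r = 0)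
    (hη₀ : η₀ ≤ 3 / 10) (hη₁ : η₁ ≤ 3 / 10) (h0 : 0 ≤ ρ) (hρ : ρ ≤ ρ₁) (hR : R ≤ ρ₁) (hD : 13 / 10 * D + 1 ≤ ρ₁) (hϱ : ρ + ρ₁ ≤ ϱ)
    (hEx : IsLocalFeature ρ₁ (flag ExM)) :
    BallAveragedPricingCapX ρ η₀ η₁ D W e κT CT DT ExM ↔ BallAveragedMotifPricingCapX ρ ϱ η₀ η₁ D W e κT CT DT ExM := by
  constructor
  · exact fun h M z hz hs c _ => h M z hz hs c
  · intro h N y hy hsep i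
    obtain ⟨M, z, c, hz, hzs, hconf, heq⟩ :=
      motif_ballAvg_of_local (surplusCapX_isLocal (e := e) (κT := κT) (CT := CT) (DT := DT) hW hR hη₀ hη₁ hD hEx) h0 hρ hϱ hy hsep i
    rw [← heq]
    exact h M z hz hzs c hconf

/-- The X motif family is finite in the motif size: only `M ≤ (20ϱ/7 + 1)³` occurs (`ϱ ≥ 0`). [folklore] -/
theorem ballAveragedMotifPricingCapX_iff_bounded {ρ ϱ η₀ η₁ D : ℝ} {W : ℝ → ℝ} {e κT CT DT : ℝ} {ExM : SitePred} (hϱ : 0 ≤ ϱ) :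
    BallAveragedMotifPricingCapX ρ ϱ η₀ η₁ D W e κT CT DT ExM ↔
      ∀ (M : ℕ), (M : ℝ) ≤ (20 * ϱ / 7 + 1) ^ 3 → ∀ (z : Fin M → E3), Function.Injective z → Sep z → ∀ c : Fin M,
        (∀ a : Fin M, dist (z a) (z c) ≤ ϱ) → 0 ≤ ballAvg ρ z (surplusCapX η₀ η₁ D W e κT CT DT ExM M z) c :=
  ⟨fun h M _ z hz hsep c hconf => h M z hz hsep c hconf,
    fun h M z hz hsep c hconf => h M (motif_card_le hϱ hz hsep hconf) z hz hsep c hconf⟩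

/-! ## §2. THE BRIDGE: the X ball book implies `Topt♭` for every cluster-level exemption implied by `ExM` -/

/-- The X-surpluses sum to at most the record right-hand side plus the allowance `D_T·#Ex` (`κ_T, C_T, D_T ≥ 0`; `ExM ⟹ Ex` on this cluster). [folklore] -/
theorem sum_surplusCapX_le {η₀ η₁ D : ℝ} {W : ℝ → ℝ} {e κT CT DT : ℝ} {ExM Ex : SitePred} (hκ : 0 ≤ κT) (hC : 0 ≤ CT) (hDT : 0 ≤ DT)
    {N : ℕ} (y : Fin N → E3) (hImp : ∀ j : Fin N, ExM N y j → Ex N y j) :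
    ∑ j, surplusCapX η₀ η₁ D W e κT CT DT ExM N y j ≤
      interactionEnergy W y - e * N - κT * (N - goodCount η₁ y) + CT * goodCount η₀ y + DT * (Nat.card {j : Fin N // Ex N y j} : ℝ) := by
  have h1 : ∑ j, surplusCapX η₀ η₁ D W e κT CT DT ExM N y j =
      (∑ j, surplusCap η₀ η₁ D W e κT CT N y j) + DT * ∑ j, flag ExM N y j := by
    unfold surplusCapX
    rw [Finset.sum_add_distrib, Finset.mul_sum]
  have h2 : ∑ j, surplusCap η₀ η₁ D W e κT CT N y j ≤ ∑ j, surplus η₀ η₁ W e κT CT y j :=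
    Finset.sum_le_sum fun j _ => surplusCap_le_surplus hκ hC N y j
  have h3 : (Nat.card {j : Fin N // ExM N y j} : ℝ) ≤ Nat.card {j : Fin N // Ex N y j} := by
    exact_mod_cast Nat.card_le_card_of_injective
      (fun i : {j : Fin N // ExM N y j} => (⟨i.1, hImp i.1 i.2⟩ : {j : Fin N // Ex N y j}))
      fun a b hab => Subtype.ext (by simpa using congrArg Subtype.val hab)
  rw [h1, sum_flag_eq_card, sum_surplus] at *
  nlinarith [mul_le_mul_of_nonneg_left h3 hDT]

/-- ★★ **THE BRIDGE `X ball book ⟹ Topt♭`** (any Schur cut `w, ω, A`, `e = eUp + A`, `ρ ≥ 0`, `κ_T, C_T, D_T ≥ 0`): for every cluster-level exemption `Ex`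
with `ExM ⟹ Ex` on injective `7/10`-separated clusters, `BallAveragedPricingCapX ρ … ExM ⟹ SchurTopologicalPricingX … C_T D_T Ex`. PROVED. [folklore] -/
theorem schurTopologicalPricingX_of_ballAveragedCapX {ρ η₀ η₁ D A eUp κT CT DT : ℝ} {w ω : ℝ → ℝ} {ExM Ex : SitePred} (hρ : 0 ≤ ρ)
    (hκ : 0 ≤ κT) (hC : 0 ≤ CT) (hDT : 0 ≤ DT)
    (hImp : ∀ (N : ℕ) (y : Fin N → E3), Function.Injective y → Sep y → ∀ j : Fin N, ExM N y j → Ex N y j)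
    (h : BallAveragedPricingCapX ρ η₀ η₁ D (effPot w ω A) (eUp + A) κT CT DT ExM) :
    SchurTopologicalPricingX η₀ η₁ w ω A eUp κT CT DT Ex := by
  intro N y hy hs
  have hsum : 0 ≤ ∑ i, ballAvg ρ y (surplusCapX η₀ η₁ D (effPot w ω A) (eUp + A) κT CT DT ExM N y) i :=
    Finset.sum_nonneg fun i _ => h N y hy hs i
  rw [sum_ballAvg hρ] at hsum
  have hle := sum_surplusCapX_le (η₀ := η₀) (η₁ := η₁) (D := D) (W := effPot w ω A) (e := eUp + A) hκ hC hDT y (hImp N y hy hs)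
  linarith

/-- ★ **Motif form of the bridge** (`ϱ ≥ ρ + ρ₁`, locality side conditions of §1). [folklore chaining] -/
theorem schurTopologicalPricingX_of_ballAveragedMotifCapX {η₀ η₁ D A eUp κT CT DT R ρ ρ₁ ϱ : ℝ} {w ω : ℝ → ℝ} {ExM Ex : SitePred}
    (hW : ∀ r, R ≤ r → effPot w ω A r = 0) (hη₀ : η₀ ≤ 3 / 10) (hη₁ : η₁ ≤ 3 / 10) (h0 : 0 ≤ ρ) (hρ : ρ ≤ ρ₁) (hR : R ≤ ρ₁)
    (hD : 13 / 10 * D + 1 ≤ ρ₁) (hϱ : ρ + ρ₁ ≤ ϱ) (hEx : IsLocalFeature ρ₁ (flag ExM)) (hκ : 0 ≤ κT) (hC : 0 ≤ CT) (hDT : 0 ≤ DT)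
    (hImp : ∀ (N : ℕ) (y : Fin N → E3), Function.Injective y → Sep y → ∀ j : Fin N, ExM N y j → Ex N y j)
    (h : BallAveragedMotifPricingCapX ρ ϱ η₀ η₁ D (effPot w ω A) (eUp + A) κT CT DT ExM) :
    SchurTopologicalPricingX η₀ η₁ w ω A eUp κT CT DT Ex :=
  schurTopologicalPricingX_of_ballAveragedCapX h0 hκ hC hDT hImp ((ballAveragedPricingCapX_iff_motif hW hη₀ hη₁ h0 hρ hR hD hϱ hEx).2 h)

/-! ## §3. EXEMPT ABSORPTION (n1) and tight absorption with the exemption column — PROVED -/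

/-- An `ExM` site within `ρ` of `i`. -/
def ExemptNear (ρ : ℝ) (ExM : SitePred) {N : ℕ} (y : Fin N → E3) (i : Fin N) : Prop := ∃ j ∈ ball ρ y i, ExM N y j

/-- X-surplus floor: `x^X_j ≥ −Dfl R B e` (`C_T, D_T ≥ 0`). [folklore] -/
theorem surplusCapX_ge {W : ℝ → ℝ} {R B e CT DT D : ℝ} {ExM : SitePred} (hW : CutBounds W R B) (hCT : 0 ≤ CT) (hDT : 0 ≤ DT) {N : ℕ}
    {y : Fin N → E3} (hs : Sep y) (j : Fin N) : -Dfl R B e ≤ surplusCapX (1 / 20) (1 / 8) D W e (1 / 100) CT DT ExM N y j :=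
  (surplusCap_ge hW hCT hs j).trans (surplusCap_le_surplusCapX hDT y j)

/-- An EXEMPT site carries `x^X_j ≥ D_T − Dfl R B e` (`C_T ≥ 0`). [folklore] -/
theorem surplusCapX_ge_of_exempt {W : ℝ → ℝ} {R B e CT DT D : ℝ} {ExM : SitePred} (hW : CutBounds W R B) (hCT : 0 ≤ CT) {N : ℕ}
    {y : Fin N → E3} (hs : Sep y) {j : Fin N} (hx : ExM N y j) : DT - Dfl R B e ≤ surplusCapX (1 / 20) (1 / 8) D W e (1 / 100) CT DT ExM N y j := by
  have h := surplusCap_ge (e := e) (D := D) hW hCT hs j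
  unfold surplusCapX
  rw [flag_eq_one hx]
  linarith

/-- A capped-tightly-good site carries `x^X_j ≥ C_T − Dfl R B e` (`D_T ≥ 0`). [folklore] -/
theorem surplusCapX_ge_of_good {W : ℝ → ℝ} {R B e CT DT D : ℝ} {ExM : SitePred} (hW : CutBounds W R B) (hDT : 0 ≤ DT) {N : ℕ}
    {y : Fin N → E3} (hs : Sep y) {j : Fin N} (hg : GoodAtScale (1 / 20) D y j) :
    CT - Dfl R B e ≤ surplusCapX (1 / 20) (1 / 8) D W e (1 / 100) CT DT ExM N y j :=
  (surplusCap_ge_of_good hW hs hg).trans (surplusCap_le_surplusCapX hDT y j)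

/-- ★ **EXEMPT ABSORPTION (PROVED)** — the critic's (n1) «OneBondExemptTransfer» in the strong form «within the book radius»: in every injective
`7/10`-separated cluster, every ball `B(i, ρ)` containing an `ExM` site has `S^X_i ≥ 0` once `D_T ≥ C_T⁰(R, B, e, ρ) = Dfl·(1 + Mball ρ²)` (`C_T ≥ 0`,
`ρ ≥ 0`; packing + crude floors). [folklore] -/
theorem exemptAbsorptionCapX {W : ℝ → ℝ} {R B e ρ CT DT D : ℝ} {ExM : SitePred} (hW : CutBounds W R B) (hρ : 0 ≤ ρ) (hCT : 0 ≤ CT)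
    (hDT : CT₀ R B e ρ ≤ DT) {N : ℕ} {y : Fin N → E3} (hs : Sep y) {i : Fin N} (hX : ExemptNear ρ ExM y i) :
    0 ≤ ballAvg ρ y (surplusCapX (1 / 20) (1 / 8) D W e (1 / 100) CT DT ExM N y) i := by
  obtain ⟨a, ha, hxa⟩ := hX
  have hD : 0 ≤ Dfl R B e := (Dfl_pos hW.range_nonneg hW.floor_nonneg).le
  have hDC := Dfl_le_CT₀ (e := e) hW.range_nonneg hW.floor_nonneg ρ
  have hDT0 : 0 ≤ DT := le_trans hD (hDC.trans hDT)
  have hM1 := one_le_Mball hρ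
  have key := sum_div_ge_of_one_large (ball ρ y i) ha (surplusCapX (1 / 20) (1 / 8) D W e (1 / 100) CT DT ExM N y)
    (fun j => ((ball ρ y j).card : ℝ)) (L := DT - Dfl R B e) (M := Mball ρ) (D := Dfl R B e) (by linarith) hD
    (fun j _ => by exact_mod_cast one_le_card_ball hρ y j) (card_ball_le hρ hs a) (card_ball_le hρ hs i)
    (fun j _ => surplusCapX_ge hW hCT hDT0 hs j) (surplusCapX_ge_of_exempt hW hCT hs hxa)
  have hMpos : 0 < Mball ρ := by linarith
  have hbound : Mball ρ * Dfl R B e ≤ (DT - Dfl R B e) / Mball ρ := by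
    rw [le_div_iff₀ hMpos]
    unfold CT₀ at hDT
    nlinarith
  unfold ballAvg
  linarith

/-- ★ **TIGHT ABSORPTION with the exemption column (PROVED)**: every ball containing a capped-tightly-good site has `S^X_i ≥ 0` once `C_T ≥ C_T⁰(R,B,e,ρ)`
(`D_T ≥ 0`). [folklore] -/
theorem tightAbsorptionCapX {W : ℝ → ℝ} {R B e ρ CT DT D : ℝ} {ExM : SitePred} (hW : CutBounds W R B) (hρ : 0 ≤ ρ) (hCT : CT₀ R B e ρ ≤ CT)
    (hDT : 0 ≤ DT) {N : ℕ} {y : Fin N → E3} (hs : Sep y) {i : Fin N} (hT : TightNearCap ρ D y i) :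
    0 ≤ ballAvg ρ y (surplusCapX (1 / 20) (1 / 8) D W e (1 / 100) CT DT ExM N y) i := by
  obtain ⟨a, ha, hga⟩ := hT
  have hD : 0 ≤ Dfl R B e := (Dfl_pos hW.range_nonneg hW.floor_nonneg).le
  have hDC := Dfl_le_CT₀ (e := e) hW.range_nonneg hW.floor_nonneg ρ
  have hCT0 : 0 ≤ CT := le_trans hD (hDC.trans hCT)
  have hM1 := one_le_Mball hρ
  have key := sum_div_ge_of_one_large (ball ρ y i) ha (surplusCapX (1 / 20) (1 / 8) D W e (1 / 100) CT DT ExM N y)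
    (fun j => ((ball ρ y j).card : ℝ)) (L := CT - Dfl R B e) (M := Mball ρ) (D := Dfl R B e) (by linarith) hD
    (fun j _ => by exact_mod_cast one_le_card_ball hρ y j) (card_ball_le hρ hs a) (card_ball_le hρ hs i)
    (fun j _ => surplusCapX_ge hW hCT0 hDT hs j) (surplusCapX_ge_of_good hW hDT hs hga)
  have hMpos : 0 < Mball ρ := by linarith
  have hbound : Mball ρ * Dfl R B e ≤ (CT - Dfl R B e) / Mball ρ := by
    rw [le_div_iff₀ hMpos]
    unfold CT₀ at hCT
    nlinarith
  unfold ballAvg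
  linarith

/-- In a capped-tight-free AND exempt-free ball both allowances are invisible: `S^X_i(C_T, D_T) = S^D_i(0)`. [folklore] -/
theorem ballAvg_surplusCapX_eq_of_free {W : ℝ → ℝ} {e ρ CT DT D : ℝ} {ExM : SitePred} {N : ℕ} {y : Fin N → E3} {i : Fin N}
    (hT : ¬TightNearCap ρ D y i) (hX : ¬ExemptNear ρ ExM y i) :
    ballAvg ρ y (surplusCapX (1 / 20) (1 / 8) D W e (1 / 100) CT DT ExM N y) i =
      ballAvg ρ y (surplusCap (1 / 20) (1 / 8) D W e (1 / 100) 0 N y) i := by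
  unfold ballAvg
  refine Finset.sum_congr rfl fun j hj => ?_
  have hng : ¬GoodAtScale (1 / 20) D y j := fun hg => hT ⟨j, hj, hg⟩
  have hnx : ¬ExM N y j := fun hx => hX ⟨j, hj, hx⟩
  simp only [surplusCapX, surplusCap, goodFlag, flag, if_neg hng, if_neg hnx, mul_zero, add_zero]

/-- **(n1) «OneBondExemptTransfer» as a statement** (critic row 552 (iv)): every injective `7/10`-separated radius-`ϱ` motif whose centre ball `B(c, ρ)`
holds an exempt site has `S^X_c(C_T, D_T) ≥ 0`.  [SUPPORT · PROVED for `D_T ≥ C_T⁰(R,B,e,ρ)`, `C_T ≥ 0` (`oneBondExemptTransfer_holds`); its instrument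
is the U-row adjacency table `ADJACENCY-U-g39.txt`: every deficit site of the jammed killers U01–U05 has an exempt site within one bond `13/10 ≤ ρ`.] -/
def OneBondExemptTransfer (ρ ϱ D : ℝ) (W : ℝ → ℝ) (e CT DT : ℝ) (ExM : SitePred) : Prop :=
  ∀ (M : ℕ) (z : Fin M → E3), Function.Injective z → Sep z → ∀ c : Fin M, (∀ a : Fin M, dist (z a) (z c) ≤ ϱ) →
    ExemptNear ρ ExM z c → 0 ≤ ballAvg ρ z (surplusCapX (1 / 20) (1 / 8) D W e (1 / 100) CT DT ExM M z) c

/-- ★ (n1) HOLDS for every admissible instance, every exemption, `D_T ≥ C_T⁰`, `C_T ≥ 0`. [folklore] -/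
theorem oneBondExemptTransfer_holds {W : ℝ → ℝ} {R B e ρ ϱ CT DT D : ℝ} {ExM : SitePred} (hW : CutBounds W R B) (hρ : 0 ≤ ρ) (hCT : 0 ≤ CT)
    (hDT : CT₀ R B e ρ ≤ DT) : OneBondExemptTransfer ρ ϱ D W e CT DT ExM :=
  fun _ _ _ hs _ _ hX => exemptAbsorptionCapX hW hρ hCT hDT hs hX

end Summit.AtomisticToContinuum.Crystallization.Theorems.FrustratedLawDichotomyExemptAbsorption

end
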